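import Literature.Probability.Divergences.EntropyEventBound
import HarnessLib

/-!
# The change-of-measure lower bound of the relative-entropy method

Topic `Literature/Probability/Divergences`; sequel of `EntropyEventBound.lean` (the entropy inequality for events
`Q(A)·log(1 + 1/P(A)) ≤ log 2 + KL(Q‖P)`, Kipnis–Landim, Appendix 1, Prop. 8.2). Read in the other direction, the same
inequality is the universal LOWER bound of large-deviation theory obtained by a change of measure ("tilting"):

* `exp_neg_le_measureReal_of_klDiv_ne_top` — for probability measures `Q, P`, a measurable `A` with `Q(A) > 0` and
  `KL(Q‖P) < ∞`: `P(A) ≥ exp(−(log 2 + KL(Q‖P))/Q(A))` (Kipnis–Landim, Appendix 1, Prop. 8.2, solved for `P(A)`).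
Along a sequence of spaces with `KL(Q_n‖P_n)/T_n → L` and `Q_n(A_n) → 1` this reads `liminf T_n⁻¹ log P_n(A_n) ≥ −L` — the lower
half of Cramér / Sanov / Lanford-type theorems; that asymptotic packaging is left to the users (e.g. the venture file
`Summits/Ventures/YMGap/RobustBall/EntropyMethodLowerBound.lean`).

Purely measure-theoretic; no topology on the spaces. Not here: the matching upper bounds (Chernoff), contraction principles.
-/

noncomputable section

open _root_.MeasureTheory _root_.InformationTheory _root_.ProbabilityTheory _root_.Filter Set
open scoped ENNReal _root_.Topology

namespace Literature.Probability.Divergences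

variable {α : Type*} [MeasurableSpace α]

/-- **Change-of-measure lower bound** (relative-entropy method): for probability measures `Q, P`, a measurable set `A` with
`Q(A) > 0` and `KL(Q‖P) < ∞`, `exp(−(log 2 + KL(Q‖P))/Q(A)) ≤ P(A)` (from `Q(A)·log(1 + 1/P(A)) ≤ log 2 + KL(Q‖P)`; if `P(A) = 0`
then `Q(A) = 0` by absolute continuity). [cite: KipnisLandim1999, Appendix 1 Prop. 8.2 (p. 338)] -/
theorem exp_neg_le_measureReal_of_klDiv_ne_top (Q P : Measure α) [IsProbabilityMeasure Q] [IsProbabilityMeasure P]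
    {A : Set α} (hA : MeasurableSet A) (hfin : klDiv Q P ≠ ⊤) (hQA : 0 < (Q A).toReal) :
    Real.exp (-((Real.log 2 + (klDiv Q P).toReal) / (Q A).toReal)) ≤ (P A).toReal := by
  have hPA : P A ≠ 0 := by
    intro h0
    have hac : Q ≪ P := (klDiv_ne_top_iff.1 hfin).1
    have hQ0 : Q A = 0 := hac h0
    rw [hQ0, ENNReal.toReal_zero] at hQA
    exact lt_irrefl _ hQA
  have h := toReal_mul_log_le_of_klDiv_ne_top Q P hA hPA hfin
  have hp0 : 0 < (P A).toReal := ENNReal.toReal_pos hPA (measure_ne_top P A)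
  have h1 : Real.log ((P A).toReal⁻¹) ≤ Real.log (1 + (P A).toReal⁻¹) :=
    Real.log_le_log (inv_pos.2 hp0) (by linarith)
  have h2 : Real.log (1 + (P A).toReal⁻¹) ≤ (Real.log 2 + (klDiv Q P).toReal) / (Q A).toReal := by
    rw [le_div_iff₀ hQA, mul_comm]
    exact h
  calc Real.exp (-((Real.log 2 + (klDiv Q P).toReal) / (Q A).toReal))
      ≤ Real.exp (-Real.log ((P A).toReal⁻¹)) := Real.exp_le_exp.2 (by linarith)
    _ = (P A).toReal := by rw [Real.log_inv, neg_neg, Real.exp_log hp0]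

end Literature.Probability.Divergences

end
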